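import Mathlib
import Summits.NavierStokesRegularity.NavierStokesRegularity.Theorems.EulerZoomLiouvillePowerGaugeEulerLiouvilleNeedleAxisymThinFastExits
import Summits.NavierStokesRegularity.NavierStokesRegularity.Theorems.EulerZoomLiouvillePowerGaugeEulerLiouvilleNeedleRace

/-!
# Needle portrait, axisymmetric case: (R) ∘ (K) — AXISYMMETRIC SWIRL-FREE SELF-SIMILAR PROFILES WITH
# POLYNOMIAL BUDGETS ARE IRROTATIONAL (ROUND-37 plate t38j, part D)

Seat nsreg-p2 (`HOME/ns-regularity-ideate-p2/ROUND-37.md`, (S37)); helper material for crux E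
(`EulerZoomLiouville.PowerGaugeEulerLiouville`, stmt-NavierStokesRegularity-19832); nothing is wired into the
LEAD's skeleton.  Composition of ns-ezl-w2's race theorem `…NeedleRace.curl_eq_zero_of_thinFastExits`
(ROUND-37 (R)) with the discharge `thinFastExits` of its hypothesis `hthin` (ROUND-37 (K): t38h, t38i, t38j A–C).
Namespace `…PowerGaugeEulerLiouville.NeedleAxisymBand`, new name only.
-/

open MeasureTheory Set Real
open scoped ENNReal
open Literature.Analysis Literature.Analysis.FluidPDE

set_option linter.dupNamespace false

namespace Summit.NavierStokesRegularity.NavierStokesRegularity.Theorems.PowerGaugeEulerLiouville.NeedleAxisymBand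

/-- **(S37) at profile level** — (R) ∘ (K): an axisymmetric swirl-free self-similar Euler profile
(`IsSelfSimilarEulerProfile γ 0 U P`, `0 < γ < 1/2`) with polynomially growing enstrophy, energy and Dirichlet
budgets on balls is irrotational (`…NeedleRace.curl_eq_zero_of_thinFastExits` with `hthin := thinFastExits`). -/
theorem curl_eq_zero_of_axisym_budgets {U : (EuclideanSpace ℝ (Fin 3)) → (EuclideanSpace ℝ (Fin 3))} {P : (EuclideanSpace ℝ (Fin 3)) → ℝ} {γ : ℝ}
    (hprof : IsSelfSimilarEulerProfile γ 0 U P) (hγ : 0 < γ) (hγ2 : γ < 1 / 2) (hax : IsAxisymmetric U)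
    (hsw : HasNoSwirl U) {CΩ q : ℝ} (hq : 0 ≤ q)
    (hcurl : ∀ L : ℝ, 1 ≤ L → ∫ z in Metric.closedBall (0 : (EuclideanSpace ℝ (Fin 3))) L, ‖curl U z‖ ^ 2 ≤ CΩ * L ^ q)
    {ρ cA cE : ℝ} (hρ : 0 ≤ ρ) (hcA : 0 ≤ cA) (hcE : 0 ≤ cE)
    (hbA : ∀ L : ℝ, 1 ≤ L →
      ∫⁻ z in Metric.closedBall (0 : (EuclideanSpace ℝ (Fin 3))) L, (‖U z‖ₑ : ℝ≥0∞) ^ 2 ≤ ENNReal.ofReal (cA * L ^ (1 - 2 * ρ)))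
    (hbE : ∀ L : ℝ, 1 ≤ L →
      ∫⁻ z in Metric.closedBall (0 : (EuclideanSpace ℝ (Fin 3))) L, (‖fderiv ℝ U z‖ₑ : ℝ≥0∞) ^ 2 ≤ ENNReal.ofReal (cE * L ^ (1 - ρ)))
    (x₀ : (EuclideanSpace ℝ (Fin 3))) : curl U x₀ = 0 :=
  NeedleRace.curl_eq_zero_of_thinFastExits hprof hγ hγ2 hax hsw hq hcurl one_pos
    (thinFastExits (hprof.contDiff_velocity.of_le (by norm_num)) hax hγ hρ hcA hcE hbA hbE) x₀

end Summit.NavierStokesRegularity.NavierStokesRegularity.Theorems.PowerGaugeEulerLiouville.NeedleAxisymBand
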